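import Literature.Topology.MaximumTheoremMovingConstraint
import Literature.MathematicalPhysics.QuantumFieldTheory.Balaban1983to89.Node00.BackgroundSelOfRecord
import Literature.MathematicalPhysics.QuantumFieldTheory.Balaban1983to89.Node00.SmallFieldChi29SelOfRecord
import Summits.QuantumFields.YangMills.Theorems.BalabanUVNodesN07DirectMethod

/-!
# NODE N09 [B12] — `hcrit` FOR THE OFFERED SELECTOR: the rooted-gauge minimiser `UkSel` and the critical configuration
# `critCfgSelOfRecord = Ū^k ∘ UkSel` are CONTINUOUS on every set of coarse data where [B11]'s minimal orbit is unique,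
# N07's closed-class minimisers are interior and the averaging of record is open at the minimisers (Berge's maximum theorem)

Cell `pub-ymgap` (YM-PLAN Track A), seat `pub-ymgap-dag-n09-w1` g6 (D-0149 width seat 1 of node N09 [B12] = [Balaban1987RG1]); count-neutral
helper of the K1-face (`--supports stmt-QuantumFields-27364 --as helper`).  [I] = [Balaban1987RG1] (CMP 109), [B7] = [Balaban1985Averaging] (CMP 98),
[B11] = [Balaban1985Variational] (CMP 102).

WHY.  After dag-n09-w1 g5 the analytic inclusion `hreg` of N09's Theorem-3 member is a theorem of per-step CHART DATA plus four displayed inputs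
(`…N09RegularityTowerOfGeometricChartData`), one of which is
`hcrit : ∀ j < K, ContinuousOn (critCfgOfRecord F N ν K j) (domAltOfRecord F N ν K (j+1))` — continuity of print's critical configuration
`V^{(j)}(W) = M^j(U_{j+1}(W))` ([I] (2.3) p. 265) on the small-field domain.  For the bare choice `Node00.Uk` (`Classical.choose` in the minimal
orbit) it is UNPROVABLE by design (dag-n09-w4 g2 `N09-SELECTION-CENSUS.md`: every selection-flavoured binder is «UNPROVABLE for the record's `Uk` ∕
THEOREM for the OFFER `UkSel`»).  THIS FILE adds the CONTINUITY row to that census: for node00-def-B's offered selector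
`Node00.UkSel F N K k e = rootGauge k ∘ (measurable selector)` (`Node00/BackgroundSelOfRecord`, p594976) continuity IS a theorem of
* (U) [B11] Thm 1's uniqueness clause `UniqueUkOrbit F N K k e V` (N07; displayed),
* (I) N07's INTERIORITY sentence VERBATIM (`…N07DirectMethodInduction.ukExists_of_closureMinimisers_mem`'s `hint`): every minimiser of the Wilson
  action over the CLOSED class `closure (bgReg e) ∩ 𝔅_k(V)` lies in the open class `bgReg e` (Prop. 7 (ii) ∕ Sect. F species; displayed),
* (E) the open-class fibre `bgReg e ∩ 𝔅_k(V)` is non-empty ([B11] Sect. A (13); displayed),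
* (O) OPENNESS OF THE AVERAGING OF RECORD AT THE MINIMISERS: for every (0.21) minimiser `U₀` over `V` and every neighbourhood `O ∋ U₀`,
  `Ū^k '' O` is a neighbourhood of `V` within `D` — the local-section ∕ one-bond-inverse species of [I] p. 267 «B′(b₀(c)) can be expressed in terms
  of the remaining variables» (dag-n09-w4 g5 `…N09OneBondChartRead`, dag-n09-w6 g3's private-coordinate road supply it; DISPLAYED here),
by BERGE'S MAXIMUM THEOREM with moving constraint (`Literature/Topology/MaximumTheoremMovingConstraint.lean`, this seat, normal-form corollary
`continuousWithinAt_of_eqOn_minimisers`) applied to: parameters = coarse fields `V`, configurations = the COMPACT space `SU(N)^{bonds}`, objective = the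
Wilson action (continuous, N07 `continuous_wilsonAction4`), moving constraint `Γ V = closure (bgReg e) ∩ 𝔅_k(V)` (compact; UPPER hemicontinuous in `V`
for free: closed graph in a compact space — N07 `isClosed_inter_fibre` ∕ `continuousOn_iter_avOfRecord_bgReg`), normal form `ρ = rootGauge k` (continuous,
§1; constant on residual orbits, `T4RootedResidualGauge.rootGauge_eq_of_orbitRel`) whose value on every minimiser over `V` is `UkSel … V`
(`Node00.rootGauge_eq_UkSel_of_isBackground` under (U)); lower hemicontinuity AT THE MINIMISERS is (O) + (I).

WHAT IS PROVED (theorems only, 0 `def`, 0 `sorry`; `e < α₀`, `α₀` admissible as in [B7] (53): `0 < α₀`, `C₀(d)α₀ ≤ ⅓`, `2α₀ ≤ c′₂`).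
§1 `continuous_lineHol` · `continuous_pathHol` · `continuous_rootTransporter_apply` · ★ `continuous_rootGauge` (topological twins of dag-n09-w4 g2's
   `T4RootedResidualGauge.measurable_*`; any topological group).
§2 `isBackground_iff_minimiser` (node00-def-B's `IsBackground` over the closed class = «feasible ∧ `IsMinOn`») · `upperHemicontinuous_inter_preimage_singleton`
   (generic: fibres of a map continuous on a compact set into a T₂ space are upper hemicontinuous) · `isCompact_closureFibre` · ★ `upperHemicontinuous_closureFibre`.
§3 ★★★ `continuousWithinAt_UkSel_of_uniqueOrbit` · ★★★ `continuousOn_UkSel_of_uniqueOrbit` (on `D`, from (U)(I)(E) on `D` and (O)).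
§4 ★★★ `continuousOn_critCfgSelOfRecord_of_uniqueOrbit` (`critCfgSelOfRecord ν K k = Ū^k ∘ UkSel (k+1) ν.εreg`; N07 `continuousAt_iter_avOfRecord_of_plaqSmall`) ·
   ★★ `hcritSel_domAlt_of_uniqueOrbit` — dag-n09-w1 g5's tower binder `hcrit` IN THE `Sel` EDITION: `∀ j < K, ContinuousOn (critCfgSelOfRecord F N ν K j)
   (domAltOfRecord F N ν K (j+1))` ⇐ (U)(I)(E)(O) on the domains.
§5 A6 ∕ non-vacuity at level `0` (`Ū^0 = id`): (U)(I)(E)(O) all HOLD on `D = bgReg K 0 e` (`levelZero_hypotheses`), so `continuousOn_UkSel_levelZero` is unconditional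
   (and `UkSel … 0 e V = V` there, `Node00.UkSel_zero_of_mem`).

HONEST FRAMING.  Count-neutral kernel TOPOLOGY (Berge 1959 ∕ Beavis–Dobbs 1990 Thm 3.6 ∕ Aliprantis–Border Thm 17.31) at NODE 00's definitions BY NAME; [B11] Thm 1
(uniqueness), N07's interiority sentence, the non-emptiness of the fibre and the openness of the averaging stay DISPLAYED hypotheses; NO carrier re-pointed (the
record's `critCfgOfRecord` still reads the bare `Uk`; `hcrit` is supplied for the OFFER `UkSel` only); `hreg` ∕ N09 NOT discharged; conjunct 1 (Lemma 4) ∕ FLAG №7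
untouched; K0⁷ ∕ K1⁹ ∕ K3⁸ NOT closed; counts unmoved (typed 28∕28 · discharged 5∕28); one finite four-torus programme at fixed `ε = L^{−K}` per run — R4 closes the
conditional rung `BalabanLadder.UV` only; NOT ℝ⁴ ∕ infinite volume ∕ OS; the Yang–Mills mass gap (Clay) is NOT proved by any of this.
-/

noncomputable section

namespace Summit.QuantumFields.YangMills.BalabanUVNodes.N09SelectorContinuousOfUniqueOrbit

open Set Filter Topology
open Literature.Topology (continuousWithinAt_of_eqOn_minimisers)
open Literature.MathematicalPhysics.QuantumFieldTheory.Balaban1983to89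
open Literature.MathematicalPhysics.QuantumFieldTheory.Balaban1983to89.T4Continuum (T4Family)
open Literature.MathematicalPhysics.QuantumFieldTheory.Balaban1983to89.Node00
open Literature.MathematicalPhysics.QuantumFieldTheory.Balaban1983to89.T4RootedResidualGauge
  (lineHol pathHol shiftN steps rootOf rootTransporter rootGauge rootGauge_eq_of_orbitRel)
open Literature.MathematicalPhysics.QuantumFieldTheory.Balaban1983to89.GaugeField (gaugeAct)
open Literature.MathematicalPhysics.QuantumFieldTheory.Balaban1983to89.ExpMeanLog (deltaSU)
open Summit.QuantumFields.YangMills.BalabanUVNodes.N07DirectMethod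
  (continuous_wilsonAction4 isCompact_of_isClosed_cfg isClosed_inter_fibre continuousOn_iter_avOfRecord_bgReg closure_bgReg_subset_bgReg
    exists_isBackground_closure_bgReg continuousAt_iter_avOfRecord_of_plaqSmall)

/-! ## §1 Continuity of the rooted residual gauge (topological twins of `T4RootedResidualGauge.measurable_*`) -/

section RootGauge

variable {P : Params} {G : Type*} [GaugeGroup G] [TopologicalSpace G] [ContinuousMul G] [ContinuousInv G]

omit [ContinuousInv G] in
/-- Line holonomies are continuous in the configuration (finite ordered products of bond variables). [cite: Balaban1985Averaging, (8) p.19 (bookkeeping)] -/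
theorem continuous_lineHol {j : ℕ} (a : Site P j) (μ : Fin P.d) : ∀ n, Continuous fun U : GaugeField P j G => lineHol U a μ n
  | 0 => continuous_const
  | n + 1 => (continuous_lineHol a μ n).mul (continuous_apply _)

omit [ContinuousInv G] in
/-- Path holonomies are continuous in the configuration. [cite: Balaban1985Averaging, (8) p.19 (bookkeeping)] -/
theorem continuous_pathHol {j : ℕ} : ∀ (a x : Site P j) (l : List (Fin P.d)), Continuous fun U : GaugeField P j G => pathHol U a x l
  | _, _, [] => continuous_const
  | a, x, μ :: l => (continuous_lineHol a μ _).mul (continuous_pathHol _ x l)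

omit [ContinuousInv G] in
/-- The rooted transporter `g_U(x)` at a site is continuous in `U`. [cite: Balaban1985Variational, (19) p.281 (bookkeeping)] -/
theorem continuous_rootTransporter_apply (k : ℕ) (x : Site P 0) : Continuous fun U : GaugeField P 0 G => rootTransporter k U x :=
  continuous_pathHol _ _ _

/-- ★ **The rooted gauge `U ↦ U^{g_U}` is a CONTINUOUS self-map of the configuration space** (any topological group: finite products and inverses of
bond variables). [cite: Balaban1985Variational, (19) p.281 (bookkeeping)] -/
theorem continuous_rootGauge (k : ℕ) : Continuous (rootGauge k : GaugeField P 0 G → GaugeField P 0 G) := by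
  refine continuous_pi fun b => ?_
  exact ((continuous_rootTransporter_apply k b.src).mul (continuous_apply b)).mul (continuous_rootTransporter_apply k b.tgt).inv

end RootGauge

/-! ## §2 The (0.21) problem over the closed class as a moving-constraint minimisation; compact, upper hemicontinuous fibres -/

section Fibres

/-- **Generic**: the fibres `C ∩ Φ⁻¹{y}` of a map `Φ` continuous on a COMPACT set `C`, with values in a Hausdorff space, form an UPPER HEMICONTINUOUS
correspondence (closed graph in a compact space: the image `Φ '' (C ∖ u)` of the compact complement of an open `u` is compact, hence closed, and misses
`y`). [cite: AliprantisBorder2006, Thm 17.31 (bookkeeping: closed graph ⇒ upper hemicontinuous)] -/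
theorem upperHemicontinuous_inter_preimage_singleton {α γ : Type*} [TopologicalSpace α] [TopologicalSpace γ] [T2Space γ]
    {C : Set α} (hC : IsCompact C) {Φ : α → γ} (hΦ : ContinuousOn Φ C) :
    UpperHemicontinuous fun y => C ∩ Φ ⁻¹' {y} := by
  refine upperHemicontinuous_iff_forall_isOpen.2 fun y u hu hsub => ?_
  have hK : IsCompact (Φ '' (C \ u)) := (hC.diff hu).image_of_continuousOn (hΦ.mono fun _ h => h.1)
  have hy : y ∉ Φ '' (C \ u) := by
    rintro ⟨a, ⟨haC, hau⟩, hay⟩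
    exact hau (hsub ⟨haC, hay⟩)
  filter_upwards [hK.isClosed.isOpen_compl.mem_nhds hy] with y' hy'
  rintro a ⟨haC, hay⟩
  by_contra hau
  exact hy' ⟨a, ⟨haC, hau⟩, hay⟩

variable {F : T4Family} {N : ℕ} [NeZero N]

/-- **DICTIONARY**: node00-def-B's `IsBackground (avOfRecord F N K) reg k V U₀` («`Ū₀^k = V`, `U₀ ∈ reg`, `A(U₀) ≤ A(U)` for every `U ∈ reg` over `V`»)
says exactly that `U₀` lies in the constraint set `reg ∩ 𝔅_k(V)` and MINIMISES the Wilson action on it (`IsMinOn`).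
[cite: Balaban1985Variational, (5)–(6), (8) p.278; Balaban1987RG1, (0.21) p.256] -/
theorem isBackground_iff_minimiser {K k : ℕ} {reg : Set (GaugeField (F.P K) 0 (SU N))} {V : GaugeField (F.P K) k (SU N)}
    {U₀ : GaugeField (F.P K) 0 (SU N)} :
    IsBackground (avOfRecord F N K) reg k V U₀ ↔
      U₀ ∈ reg ∩ Averaging.iter (avOfRecord F N K) k ⁻¹' {V} ∧
        IsMinOn (fun U => wilsonAction4 U) (reg ∩ Averaging.iter (avOfRecord F N K) k ⁻¹' {V}) U₀ := by
  rw [isMinOn_iff]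
  constructor
  · rintro ⟨hV, hreg, hmin⟩
    exact ⟨⟨hreg, hV⟩, fun U hU => hmin U hU.1 hU.2⟩
  · rintro ⟨⟨hreg, hV⟩, hmin⟩
    exact ⟨hV, hreg, fun U hU hUV => hmin U ⟨hU, hUV⟩⟩

/-- The closed-class fibre `closure (bgReg e) ∩ 𝔅_k(V)` is COMPACT (`e < α₀` admissible as in (53); N07 `isClosed_inter_fibre` in the compact configuration
space). [cite: Balaban1985Variational, (3), (6) p.278] -/
theorem isCompact_closureFibre (K k : ℕ) {e α₀ : ℝ} (he : e < α₀) (hα : 0 < α₀)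
    (hα3 : (143 * (((((F.P K).d + 4 : ℕ) : ℝ)) ^ 2 / 4) ^ 2) * α₀ ≤ 1 / 3)
    (hα2 : 2 * α₀ ≤ 2 * deltaSU (Fin N) / ((((F.P K).d + 4) * (F.P K).L : ℕ) : ℝ) ^ 2) (V : GaugeField (F.P K) k (SU N)) :
    IsCompact (closure (bgReg F N K k e) ∩ Averaging.iter (avOfRecord F N K) k ⁻¹' {V}) :=
  isCompact_of_isClosed_cfg (isClosed_inter_fibre K k hα hα3 hα2 isClosed_closure (closure_bgReg_subset_bgReg K k he) V)

/-- ★ **The closed-class fibres are UPPER HEMICONTINUOUS in the coarse field** (closed graph: `Ū^k` is continuous on `closure (bgReg e) ⊆ bgReg α₀`,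
N07 `continuousOn_iter_avOfRecord_bgReg`, and the configuration space is compact Hausdorff). [cite: Balaban1985Variational, (3), (6) p.278; Balaban1987RG1, (0.21) p.256] -/
theorem upperHemicontinuous_closureFibre (K k : ℕ) {e α₀ : ℝ} (he : e < α₀) (hα : 0 < α₀)
    (hα3 : (143 * (((((F.P K).d + 4 : ℕ) : ℝ)) ^ 2 / 4) ^ 2) * α₀ ≤ 1 / 3)
    (hα2 : 2 * α₀ ≤ 2 * deltaSU (Fin N) / ((((F.P K).d + 4) * (F.P K).L : ℕ) : ℝ) ^ 2) :
    UpperHemicontinuous fun V : GaugeField (F.P K) k (SU N) => closure (bgReg F N K k e) ∩ Averaging.iter (avOfRecord F N K) k ⁻¹' {V} := by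
  haveI : T2Space (GaugeField (F.P K) k (SU N)) := inferInstanceAs (T2Space (PBond (F.P K) k → SU N))
  exact upperHemicontinuous_inter_preimage_singleton (isCompact_of_isClosed_cfg isClosed_closure)
    ((continuousOn_iter_avOfRecord_bgReg K k hα hα3 hα2).mono (closure_bgReg_subset_bgReg K k he))

/-- ₈a's class `bgReg K k e = {U | |U(∂p) − 1| < eη_k² ∀p}` is OPEN (strict inequalities of continuous plaquette letters; K0c's `isOpen_plaqSmall`).
[cite: Balaban1987RG1, (1.2) p.260 (bookkeeping)] -/
theorem isOpen_bgReg' (K k : ℕ) (e : ℝ) : IsOpen (bgReg F N K k e) :=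
  isOpen_plaqSmall _

/-- Under N07's INTERIORITY sentence, a closed-class minimiser is an open-class minimiser (node00-def-B's `IsBackground` over `bgReg e`).
[cite: Balaban1985Variational, Thm 1 (8) p.279, Prop. 7 p.299] -/
theorem isBackground_of_closureMinimiser {K k : ℕ} {e : ℝ} {V : GaugeField (F.P K) k (SU N)} {U₀ : GaugeField (F.P K) 0 (SU N)}
    (hint : ∀ U₀ : GaugeField (F.P K) 0 (SU N),
      IsBackground (avOfRecord F N K) (closure (bgReg F N K k e)) k V U₀ → U₀ ∈ bgReg F N K k e)
    (hU₀ : U₀ ∈ closure (bgReg F N K k e) ∩ Averaging.iter (avOfRecord F N K) k ⁻¹' {V})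
    (hmin : IsMinOn (fun U => wilsonAction4 U) (closure (bgReg F N K k e) ∩ Averaging.iter (avOfRecord F N K) k ⁻¹' {V}) U₀) :
    IsBackground (avOfRecord F N K) (bgReg F N K k e) k V U₀ := by
  have hc : IsBackground (avOfRecord F N K) (closure (bgReg F N K k e)) k V U₀ := isBackground_iff_minimiser.2 ⟨hU₀, hmin⟩
  exact ⟨hc.1, hint U₀ hc, fun U hU hUV => hc.2.2 U (subset_closure hU) hUV⟩

end Fibres

/-! ## §3 `UkSel` is continuous where the minimal orbit is unique, closed-class minimisers are interior and the averaging is open -/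

section Selector

variable {F : T4Family} {N : ℕ} [NeZero N]

/-- ★★★ **CONTINUITY OF THE OFFERED SELECTOR AT A POINT.**  Let `e < α₀` (`α₀` admissible as in (53)), `k ≤ m + K`, `D` a set of coarse fields and
`V₀ ∈ D`.  Assume, for every `V ∈ D`: (E) the open-class fibre `bgReg e ∩ 𝔅_k(V)` is non-empty; (I) every minimiser of the Wilson action over the CLOSED class
`closure (bgReg e) ∩ 𝔅_k(V)` lies in `bgReg e` (N07's displayed interiority sentence, verbatim); (U) `UniqueUkOrbit F N K k e V` ([B11] Thm 1); and at `V₀`: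
(O) for every (0.21) minimiser `U₀` over `V₀` and every neighbourhood `O` of `U₀`, `Ū^k '' O` is a neighbourhood of `V₀` within `D` (openness of the
averaging of record at the minimisers).  THEN `Node00.UkSel F N K k e` is continuous at `V₀` within `D`.  Berge's maximum theorem (moving constraint,
normal form `rootGauge k`). [cite: Balaban1985Variational, Thm 1 p.279 and (181) p.307; Balaban1987RG1, (0.21) p.256, (2.3) p.265] -/
theorem continuousWithinAt_UkSel_of_uniqueOrbit (K k : ℕ) {e α₀ : ℝ} (he : e < α₀) (hα : 0 < α₀)
    (hα3 : (143 * (((((F.P K).d + 4 : ℕ) : ℝ)) ^ 2 / 4) ^ 2) * α₀ ≤ 1 / 3)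
    (hα2 : 2 * α₀ ≤ 2 * deltaSU (Fin N) / ((((F.P K).d + 4) * (F.P K).L : ℕ) : ℝ) ^ 2) (hk : k ≤ (F.P K).m + (F.P K).K)
    {D : Set (GaugeField (F.P K) k (SU N))} {V₀ : GaugeField (F.P K) k (SU N)} (hV₀ : V₀ ∈ D)
    (hne : ∀ V ∈ D, ∃ U ∈ bgReg F N K k e, Averaging.iter (avOfRecord F N K) k U = V)
    (hint : ∀ V ∈ D, ∀ U₀ : GaugeField (F.P K) 0 (SU N),
      IsBackground (avOfRecord F N K) (closure (bgReg F N K k e)) k V U₀ → U₀ ∈ bgReg F N K k e)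
    (huniq : ∀ V ∈ D, UniqueUkOrbit F N K k e V)
    (hopen : ∀ U₀ : GaugeField (F.P K) 0 (SU N), IsBackground (avOfRecord F N K) (bgReg F N K k e) k V₀ U₀ →
      ∀ O ∈ 𝓝 U₀, Averaging.iter (avOfRecord F N K) k '' O ∈ 𝓝[D] V₀) :
    ContinuousWithinAt (UkSel F N K k e) D V₀ := by
  -- the data of Berge's theorem
  set Φ : GaugeField (F.P K) 0 (SU N) → GaugeField (F.P K) k (SU N) := Averaging.iter (avOfRecord F N K) k with hΦ
  set Γ : GaugeField (F.P K) k (SU N) → Set (GaugeField (F.P K) 0 (SU N)) := fun V => closure (bgReg F N K k e) ∩ Φ ⁻¹' {V} with hΓ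
  have hFc : ∀ U ∈ Γ V₀, ContinuousAt (fun p : GaugeField (F.P K) k (SU N) × GaugeField (F.P K) 0 (SU N) => wilsonAction4 p.2) (V₀, U) :=
    fun _ _ => (continuous_wilsonAction4.comp continuous_snd).continuousAt
  have hΓc : IsCompact (Γ V₀) := isCompact_closureFibre K k he hα hα3 hα2 V₀
  have hup : UpperHemicontinuousWithinAt Γ D V₀ :=
    fun t ht => ((upperHemicontinuous_closureFibre K k he hα hα3 hα2) V₀ t ht).filter_mono nhdsWithin_le_nhds
  -- the value of the normal form on every closed-class minimiser over `V ∈ D`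
  have hval : ∀ V ∈ D, ∀ U ∈ Γ V, IsMinOn (fun U => wilsonAction4 U) (Γ V) U → rootGauge k U = UkSel F N K k e V :=
    fun V hV U hU hmin => rootGauge_eq_UkSel_of_isBackground hk (huniq V hV) (isBackground_of_closureMinimiser (hint V hV) hU hmin)
  -- lower hemicontinuity at the minimisers from (O) + (I)
  have hlow : ∀ U ∈ Γ V₀, IsMinOn (fun U => wilsonAction4 U) (Γ V₀) U →
      ∀ u : Set (GaugeField (F.P K) 0 (SU N)), IsOpen u → U ∈ u → ∀ᶠ V in 𝓝[D] V₀, (Γ V ∩ u).Nonempty := by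
    intro U hU hmin u hu hUu
    have hbg : IsBackground (avOfRecord F N K) (bgReg F N K k e) k V₀ U := isBackground_of_closureMinimiser (hint V₀ hV₀) hU hmin
    have hO : u ∩ bgReg F N K k e ∈ 𝓝 U := (hu.inter (isOpen_bgReg' K k e)).mem_nhds ⟨hUu, hbg.2.1⟩
    filter_upwards [hopen U hbg _ hO] with V hV
    obtain ⟨U', ⟨hU'u, hU'bg⟩, hU'V⟩ := hV
    exact ⟨U', ⟨subset_closure hU'bg, hU'V⟩, hU'u⟩
  refine continuousWithinAt_of_eqOn_minimisers (F := fun p => wilsonAction4 p.2) (Γ := Γ) (ρ := rootGauge k) hFc hΓc hup hlow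
    (fun U hU hmin => ⟨(continuous_rootGauge k).continuousAt, hval V₀ hV₀ U hU hmin⟩) ?_
  filter_upwards [eventually_mem_nhdsWithin] with V hV
  refine ⟨?_, hval V hV⟩
  obtain ⟨U₀, h₀⟩ := exists_isBackground_closure_bgReg K k he hα hα3 hα2 (hne V hV)
  exact ⟨U₀, (isBackground_iff_minimiser.1 h₀).1, (isBackground_iff_minimiser.1 h₀).2⟩

/-- ★★★ **CONTINUITY OF THE OFFERED SELECTOR ON A SET**: (E), (I), (U) and (O) at every `V ∈ D` ⟹ `Node00.UkSel F N K k e` is continuous ON `D`.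
[cite: Balaban1985Variational, Thm 1 p.279 and (181) p.307; Balaban1987RG1, (0.21) p.256, (2.3) p.265] -/
theorem continuousOn_UkSel_of_uniqueOrbit (K k : ℕ) {e α₀ : ℝ} (he : e < α₀) (hα : 0 < α₀)
    (hα3 : (143 * (((((F.P K).d + 4 : ℕ) : ℝ)) ^ 2 / 4) ^ 2) * α₀ ≤ 1 / 3)
    (hα2 : 2 * α₀ ≤ 2 * deltaSU (Fin N) / ((((F.P K).d + 4) * (F.P K).L : ℕ) : ℝ) ^ 2) (hk : k ≤ (F.P K).m + (F.P K).K)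
    {D : Set (GaugeField (F.P K) k (SU N))}
    (hne : ∀ V ∈ D, ∃ U ∈ bgReg F N K k e, Averaging.iter (avOfRecord F N K) k U = V)
    (hint : ∀ V ∈ D, ∀ U₀ : GaugeField (F.P K) 0 (SU N),
      IsBackground (avOfRecord F N K) (closure (bgReg F N K k e)) k V U₀ → U₀ ∈ bgReg F N K k e)
    (huniq : ∀ V ∈ D, UniqueUkOrbit F N K k e V)
    (hopen : ∀ V ∈ D, ∀ U₀ : GaugeField (F.P K) 0 (SU N), IsBackground (avOfRecord F N K) (bgReg F N K k e) k V U₀ →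
      ∀ O ∈ 𝓝 U₀, Averaging.iter (avOfRecord F N K) k '' O ∈ 𝓝[D] V) :
    ContinuousOn (UkSel F N K k e) D :=
  fun V₀ hV₀ => continuousWithinAt_UkSel_of_uniqueOrbit K k he hα hα3 hα2 hk hV₀ hne hint huniq (hopen V₀ hV₀)

end Selector

/-! ## §4 The critical configuration `V^{(k),Sel} = Ū^k ∘ UkSel (k+1)` is continuous; the `hcrit` binder of the tower in the `Sel` edition -/

section CritCfg

variable {F : T4Family} {N : ℕ} [NeZero N]

/-- The offered selector's value over `V` is `α₀η_{k}²`-small (it lies in `bgReg e ⊆ bgReg α₀` on the solvable set, is `1` off it).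
[cite: Balaban1987RG1, (1.2) p.260 (bookkeeping)] -/
theorem plaqSmall_UkSel (K k : ℕ) {e α₀ : ℝ} (he : e < α₀) (hα : 0 < α₀) (hk : k ≤ (F.P K).m + (F.P K).K)
    (V : GaugeField (F.P K) k (SU N)) : PlaqSmall (α₀ * (F.P K).eta k ^ 2) (UkSel F N K k e V) := by
  have hη : 0 < (F.P K).eta k ^ 2 := pow_pos (pow_pos (inv_pos.mpr (Nat.cast_pos.mpr (F.P K).L_pos)) k) 2
  by_cases h : UkExists F N K k e V
  · have hmem : UkSel F N K k e V ∈ bgReg F N K k e := (isBackground_UkSel hk h).2.1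
    exact fun p => ((mem_bgReg_iff F N K k e _).1 hmem p).trans (mul_lt_mul_of_pos_right he hη)
  · rw [UkSel_of_not h]
    intro p
    have hb : ∀ b, (1 : GaugeField (F.P K) 0 (SU N)) b = 1 := fun _ => rfl
    have h1 : GaugeField.plaqHol (1 : GaugeField (F.P K) 0 (SU N)) p = 1 := by simp [GaugeField.plaqHol, hb]
    rw [h1, GaugeGroup.dist1_one]
    exact mul_pos hα hη

/-- ★★★ **THE CRITICAL CONFIGURATION OF RECORD, `Sel` EDITION, IS CONTINUOUS** on every set `D` of level-`(k+1)` data carrying (E), (I), (U), (O) at radius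
`ν.εreg < α₀` (`α₀` admissible as in (53)): `critCfgSelOfRecord ν K k = Ū^k ∘ UkSel (k+1) ν.εreg` ([I] (2.3)) — §3 composed with the continuity of `Ū^k` at
`(52)`-small configurations (N07 `continuousAt_iter_avOfRecord_of_plaqSmall`, [B7] Prop. 2).
[cite: Balaban1987RG1, (2.3) p.265; Balaban1985Averaging, Prop. 2 (52)–(54) p.26; Balaban1985Variational, Thm 1 p.279] -/
theorem continuousOn_critCfgSelOfRecord_of_uniqueOrbit (ν : Stage7Numerics) (K k : ℕ) {α₀ : ℝ} (he : ν.εreg < α₀) (hα : 0 < α₀)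
    (hα3 : (143 * (((((F.P K).d + 4 : ℕ) : ℝ)) ^ 2 / 4) ^ 2) * α₀ ≤ 1 / 3)
    (hα2 : 2 * α₀ ≤ 2 * deltaSU (Fin N) / ((((F.P K).d + 4) * (F.P K).L : ℕ) : ℝ) ^ 2) (hk : k + 1 ≤ (F.P K).m + (F.P K).K)
    {D : Set (GaugeField (F.P K) (k + 1) (SU N))}
    (hne : ∀ W ∈ D, ∃ U ∈ bgReg F N K (k + 1) ν.εreg, Averaging.iter (avOfRecord F N K) (k + 1) U = W)
    (hint : ∀ W ∈ D, ∀ U₀ : GaugeField (F.P K) 0 (SU N),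
      IsBackground (avOfRecord F N K) (closure (bgReg F N K (k + 1) ν.εreg)) (k + 1) W U₀ → U₀ ∈ bgReg F N K (k + 1) ν.εreg)
    (huniq : ∀ W ∈ D, UniqueUkOrbit F N K (k + 1) ν.εreg W)
    (hopen : ∀ W ∈ D, ∀ U₀ : GaugeField (F.P K) 0 (SU N), IsBackground (avOfRecord F N K) (bgReg F N K (k + 1) ν.εreg) (k + 1) W U₀ →
      ∀ O ∈ 𝓝 U₀, Averaging.iter (avOfRecord F N K) (k + 1) '' O ∈ 𝓝[D] W) :
    ContinuousOn (critCfgSelOfRecord F N ν K k) D := by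
  intro W₀ hW₀
  have hsel : ContinuousWithinAt (UkSel F N K (k + 1) ν.εreg) D W₀ :=
    continuousWithinAt_UkSel_of_uniqueOrbit K (k + 1) he hα hα3 hα2 hk hW₀ hne hint huniq (hopen W₀ hW₀)
  have hiter : ContinuousAt (Averaging.iter (avOfRecord F N K) k) (UkSel F N K (k + 1) ν.εreg W₀) :=
    continuousAt_iter_avOfRecord_of_plaqSmall K (k + 1) hα hα3 hα2 (plaqSmall_UkSel K (k + 1) he hα hk W₀) k (Nat.le_succ k)
  exact hiter.comp_continuousWithinAt hsel

/-- ★★ **dag-n09-w1 g5's TOWER BINDER `hcrit`, `Sel` EDITION**: on every torus of the `K`-th approximation, at every step `j < K`, the critical configuration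
`V^{(j),Sel}` is continuous on the small-field domain `domAltOfRecord ν K (j+1)` — the exact shape of the `hcrit` hypothesis of
`…N09RegularityTowerOfGeometricChartData.continuousOn_effActionHT_all_of_geometricChartData` with `critCfgOfRecord ↦ critCfgSelOfRecord` — provided the
domains carry (E) [B11] Sect. A solvability in the open class, (I) N07's interiority, (U) [B11] Thm 1 uniqueness and (O) openness of the averaging at the
minimisers, at radius `ν.εreg < α₀` (`α₀` admissible as in (53)).  Standing range from `(F.P K).K = K`, `1 ≤ (F.P K).m`.
[cite: Balaban1987RG1, (2.3) p.265 and p.259; Balaban1985Variational, Thm 1 p.279] -/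
theorem hcritSel_domAlt_of_uniqueOrbit (ν : Stage7Numerics) (K : ℕ) {α₀ : ℝ} (he : ν.εreg < α₀) (hα : 0 < α₀)
    (hα3 : (143 * (((((F.P K).d + 4 : ℕ) : ℝ)) ^ 2 / 4) ^ 2) * α₀ ≤ 1 / 3)
    (hα2 : 2 * α₀ ≤ 2 * deltaSU (Fin N) / ((((F.P K).d + 4) * (F.P K).L : ℕ) : ℝ) ^ 2)
    (hne : ∀ j < K, ∀ W ∈ domAltOfRecord F N ν K (j + 1), ∃ U ∈ bgReg F N K (j + 1) ν.εreg, Averaging.iter (avOfRecord F N K) (j + 1) U = W)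
    (hint : ∀ j < K, ∀ W ∈ domAltOfRecord F N ν K (j + 1), ∀ U₀ : GaugeField (F.P K) 0 (SU N),
      IsBackground (avOfRecord F N K) (closure (bgReg F N K (j + 1) ν.εreg)) (j + 1) W U₀ → U₀ ∈ bgReg F N K (j + 1) ν.εreg)
    (huniq : ∀ j < K, ∀ W ∈ domAltOfRecord F N ν K (j + 1), UniqueUkOrbit F N K (j + 1) ν.εreg W)
    (hopen : ∀ j < K, ∀ W ∈ domAltOfRecord F N ν K (j + 1), ∀ U₀ : GaugeField (F.P K) 0 (SU N),
      IsBackground (avOfRecord F N K) (bgReg F N K (j + 1) ν.εreg) (j + 1) W U₀ →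
      ∀ O ∈ 𝓝 U₀, Averaging.iter (avOfRecord F N K) (j + 1) '' O ∈ 𝓝[domAltOfRecord F N ν K (j + 1)] W) :
    ∀ j < K, ContinuousOn (critCfgSelOfRecord F N ν K j) (domAltOfRecord F N ν K (j + 1)) := by
  intro j hj
  have hk : j + 1 ≤ (F.P K).m + (F.P K).K := by
    rw [T4Family.P_K]
    have := (F.P K).m
    omega
  exact continuousOn_critCfgSelOfRecord_of_uniqueOrbit ν K j he hα hα3 hα2 hk (hne j hj) (hint j hj) (huniq j hj) (hopen j hj)

end CritCfg

/-! ## §5 A6 ∕ non-vacuity: at level `0` all four hypotheses HOLD on `D = bgReg K 0 e`, so the selector is unconditionally continuous there -/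

section LevelZero

variable {F : T4Family} {N : ℕ} [NeZero N]

/-- At level `0` (`Ū^0 = id`) the four displayed hypotheses of §3 hold on `D := bgReg K 0 e`: (E) `V` itself is the open-class fibre point; (I) the closed-class
fibre over `V` is `{V}`, interior since `V ∈ bgReg 0 e`; (U) `Node00.uniqueUkOrbit_zero`; (O) `id '' O = O` is a neighbourhood of `V`.
[cite: Balaban1987RG1, (0.21) p.256 (level-zero bookkeeping)] -/
theorem levelZero_hypotheses (K : ℕ) (e : ℝ) :
    (∀ V ∈ bgReg F N K 0 e, ∃ U ∈ bgReg F N K 0 e, Averaging.iter (avOfRecord F N K) 0 U = V) ∧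
    (∀ V ∈ bgReg F N K 0 e, ∀ U₀ : GaugeField (F.P K) 0 (SU N),
      IsBackground (avOfRecord F N K) (closure (bgReg F N K 0 e)) 0 V U₀ → U₀ ∈ bgReg F N K 0 e) ∧
    (∀ V ∈ bgReg F N K 0 e, UniqueUkOrbit F N K 0 e V) ∧
    (∀ V ∈ bgReg F N K 0 e, ∀ U₀ : GaugeField (F.P K) 0 (SU N), IsBackground (avOfRecord F N K) (bgReg F N K 0 e) 0 V U₀ →
      ∀ O ∈ 𝓝 U₀, Averaging.iter (avOfRecord F N K) 0 '' O ∈ 𝓝[bgReg F N K 0 e] V) := by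
  refine ⟨fun V hV => ⟨V, hV, rfl⟩, fun V hV U₀ h => ?_, fun V _ => uniqueUkOrbit_zero V, fun V _ U₀ h O hO => ?_⟩
  · have hU₀ : U₀ = V := h.1
    rw [hU₀]
    exact hV
  · have hU₀ : U₀ = V := h.1
    subst hU₀
    have hO' : Averaging.iter (avOfRecord F N K) 0 '' O = O := image_id O
    rw [hO']
    exact mem_nhdsWithin_of_mem_nhds hO

/-- **Level-`0` instance, unconditional**: `Node00.UkSel F N K 0 e` is continuous on `bgReg K 0 e` for every `e < α₀` (`α₀` admissible as in (53)) — where it is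
the identity (`Node00.UkSel_zero_of_mem`); an A6 witness that §3's hypotheses are jointly satisfiable at NODE 00's objects.
[cite: Balaban1987RG1, (0.21) p.256 (level-zero bookkeeping)] -/
theorem continuousOn_UkSel_levelZero (K : ℕ) {e α₀ : ℝ} (he : e < α₀) (hα : 0 < α₀)
    (hα3 : (143 * (((((F.P K).d + 4 : ℕ) : ℝ)) ^ 2 / 4) ^ 2) * α₀ ≤ 1 / 3)
    (hα2 : 2 * α₀ ≤ 2 * deltaSU (Fin N) / ((((F.P K).d + 4) * (F.P K).L : ℕ) : ℝ) ^ 2) :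
    ContinuousOn (UkSel F N K 0 e) (bgReg F N K 0 e) := by
  obtain ⟨hne, hint, huniq, hopen⟩ := levelZero_hypotheses (F := F) (N := N) K e
  exact continuousOn_UkSel_of_uniqueOrbit K 0 he hα hα3 hα2 (Nat.zero_le _) hne hint huniq hopen

end LevelZero

end Summit.QuantumFields.YangMills.BalabanUVNodes.N09SelectorContinuousOfUniqueOrbit

end
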